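import Summits.HodgeConjecture.HodgeConjecture.Theorems.F0P3bPNullIrreducible
import Summits.HodgeConjecture.HodgeConjecture.Theorems.F0P3bStubT3jCocycleValuesPNull
import HarnessLib

/-!
# FLOOR-0 P3b «ENGINE local packets» — infrastructure IV: the values `f(Y) ∈ V` of a closed `(𝔤, K)`-1-cochain of
# type `δ` of a `(𝔤, K)`-module of `U(α, β)`, and the null core `E_f` they span

Cell hodgecm-mathlib, FLOOR 0, crux item H413 = stmt-HodgeConjecture-24833; sub-line
`Cruxes/H413/Lines/F0_EngineLocalPackets.lean` (F0P3b-plan, ed. 1 808dda7d).  Helper file (one light definition `cval`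
+ lemmas), author F0P3-p01 (g2); consumed by the closers of the registered stubs T6b (`dim ≤ 1`) and T6c (rigidity).
NO unitarity, NO admissibility, NO classification (★ `F0P3bPPartOperators`, ★ `F0P3bPNullGeneration`,
★ `F0P3bPNullIrreducible`, ★ T3j `F0P3bStubT3jCocycleValuesPNull`).

Content ([BorelWallach2000, I §5.1, II §4.1–4.2]).  `cval ρ𝔤 f Y = f(Y)` is the value of the `1`-cochain `f` read in
the carrier `V` (the tree's `Cochain … (GKCarrier _ ρ𝔤) 1` takes values in the type synonym `GKCarrier`; reading them in
`V` lets the `V`-level operators `ρ𝔤 X`, `ρK k`, `pOp`, `Module.End.eigenspace` act on them without friction).  For a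
closed `(𝔤, K)`-1-cochain `f` of type `δ` (`δ² = 1`, `μ = δ i`): `f(𝔨) = 0`, `f(Ad k Y) = ρK k f(Y)`, `f(JY) = μ f(Y)`,
`f(⁅W, Y⁆) = ρW f(Y)` (`W ∈ 𝔨`), `f(X_{cE_p}) = (Re c + μ Im c) f(X_{E_p})`, every value lies in
`E_f = span_ℂ {f(X_{E_p})}`, and `E_f` is a null core of weight `μ` (★ T3j); in an IRREDUCIBLE module with `f ≠ 0`,
`eigenspace(ρz₀, μ) = E_f` (★ `eigenspace_eq_of_isNullCore`) — so the values of ANY closed cochain of type `δ` lie in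
`E_f` (`cval_mem_span_of_ne_zero`).

HONEST LABEL: HC_CM is proved only modulo the printed citations until rung 0 closes; this file discharges none of them.
-/

-- Mathlib idiom (as in `GKModules`, `GKCohomology`, the `Upq*` files and the Lines file): commutator bracket on `Module.End`
attribute [local instance 100] LieRing.ofAssociativeRing

set_option autoImplicit false
set_option linter.dupNamespace false

noncomputable section

namespace Summit.HodgeConjecture.HodgeConjecture.Cruxes.H413.F0P3bCochainValues

open Literature.Algebra.Lie Literature.Algebra.Lie.ChevalleyEilenberg
open Literature.NumberTheory.Automorphic
open Literature.RepresentationTheory.BorelWallach2000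
open Literature.RepresentationTheory.KonnoKonno2007 Literature.RepresentationTheory.KonnoKonno2007.RealDualPair
open Literature.RepresentationTheory.KonnoKonno2007.RealDualPair.UForm
open Summit.HodgeConjecture.HodgeConjecture.Cruxes.H413.F0P3bPPartOperators
open Summit.HodgeConjecture.HodgeConjecture.Cruxes.H413.F0P3bPNullGeneration
open Summit.HodgeConjecture.HodgeConjecture.Cruxes.H413.F0P3bPNullIrreducible
open Summit.HodgeConjecture.HodgeConjecture.Cruxes.H413.F0P3bStubT3jCocycleValuesPNull

variable {α β : Type} [Fintype α] [DecidableEq α] [Fintype β] [DecidableEq β]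
  {V : Type} [AddCommGroup V] [Module ℂ V]
  (ρK : Representation ℂ (uFormGroup α β).maximalCompact V)
  (ρ𝔤 : (uFormGroup α β).lie →ₗ⁅ℝ⁆ Module.End ℂ V)
  (hV : ∀ (k : (uFormGroup α β).maximalCompact) (X : (uFormGroup α β).lie), ρK k ∘ₗ ρ𝔤 X ∘ₗ ρK k⁻¹ =
    ρ𝔤 ((uFormGroup α β).Ad (Subgroup.inclusion (uFormGroup α β).maximalCompact_le_carrier k) X))

/-! ## §1 Values of a `1`-cochain, read in `V` -/

/-- **The value `f(Y) ∈ V` of a `1`-cochain `f` of the `𝔤`-module `GKCarrier _ ρ𝔤` (`= V` as a type)**.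
[cite: BorelWallach2000, I §5.1 (1)] -/
def cval (f : Cochain ℝ (uFormGroup α β).lie (GKCarrier (uFormGroup α β) ρ𝔤) 1) (Y : (uFormGroup α β).lie) : V :=
  f ![Y]

variable (f : Cochain ℝ (uFormGroup α β).lie (GKCarrier (uFormGroup α β) ρ𝔤) 1)

/-- Unfolding (the two sides live in the definitionally equal types `V` and `GKCarrier`). [folklore] -/
theorem cval_def (Y : (uFormGroup α β).lie) : cval ρ𝔤 f Y = f ![Y] := rfl

/-- `f ↦ f(Y)` is additive in `f`. [folklore] -/
theorem cval_add_left (g : Cochain ℝ (uFormGroup α β).lie (GKCarrier (uFormGroup α β) ρ𝔤) 1) (Y : (uFormGroup α β).lie) :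
    cval ρ𝔤 (f + g) Y = cval ρ𝔤 f Y + cval ρ𝔤 g Y := rfl

/-- `f ↦ f(Y)` is `ℂ`-homogeneous in `f`. [folklore] -/
theorem cval_smul_left (c : ℂ) (Y : (uFormGroup α β).lie) : cval ρ𝔤 (c • f) Y = c • cval ρ𝔤 f Y := rfl

/-- A `1`-cochain vanishes iff all its values do. [folklore] -/
theorem eq_zero_iff_cval : f = 0 ↔ ∀ Y, cval ρ𝔤 f Y = 0 := by
  constructor
  · rintro rfl Y
    rfl
  · intro h
    refine AlternatingMap.ext fun v => ?_
    have hv : v = ![v 0] := by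
      funext i
      fin_cases i
      rfl
    rw [hv]
    exact h (v 0)

/-- Two `1`-cochains with proportional values are proportional. [folklore] -/
theorem eq_smul_of_cval (g : Cochain ℝ (uFormGroup α β).lie (GKCarrier (uFormGroup α β) ρ𝔤) 1) (c : ℂ)
    (h : ∀ Y, cval ρ𝔤 g Y = c • cval ρ𝔤 f Y) : g = c • f := by
  refine AlternatingMap.ext fun v => ?_
  have hv : v = ![v 0] := by
    funext i
    fin_cases i
    rfl
  rw [hv]
  exact h (v 0)

/-- Additivity in the argument. [folklore] -/
theorem cval_add (X Y : (uFormGroup α β).lie) : cval ρ𝔤 f (X + Y) = cval ρ𝔤 f X + cval ρ𝔤 f Y :=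
  f.map_vecCons_add ![] X Y

/-- Real homogeneity in the argument (read with complex scalars in `V`). [folklore] -/
theorem cval_smul (r : ℝ) (X : (uFormGroup α β).lie) : cval ρ𝔤 f (r • X) = (r : ℂ) • cval ρ𝔤 f X :=
  f.map_vecCons_smul ![] r X

/-- Values on a finite real combination. [folklore] -/
theorem cval_sum_smul {ι : Type} [Fintype ι] (c : ι → ℝ) (X : ι → (uFormGroup α β).lie) :
    cval ρ𝔤 f (∑ i, c i • X i) = ∑ i, (c i : ℂ) • cval ρ𝔤 f (X i) := by
  classical
  induction (Finset.univ : Finset ι) using Finset.induction_on with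
  | empty =>
    rw [Finset.sum_empty, Finset.sum_empty]
    have h := cval_smul ρ𝔤 f 0 0
    rwa [zero_smul, Complex.ofReal_zero, zero_smul] at h
  | insert i s hi ih => rw [Finset.sum_insert hi, Finset.sum_insert hi, cval_add, cval_smul, ih]

/-! ## §2 Closed `(𝔤, K)`-1-cochains of type `δ` -/

include hV in
/-- A `(𝔤, K)`-1-cochain vanishes on `𝔨` (relative cochain). [cite: BorelWallach2000, I §5.1 (2)] -/
theorem cval_eq_zero_of_mem_kInLie (hfC : f ∈ (gkComplex (uFormGroup α β) ρK ρ𝔤 hV).carrier 1)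
    (W : (uFormGroup α β).lie) (hW : W ∈ (uFormGroup α β).kInLie) : cval ρ𝔤 f W = 0 := by
  have h := (((mem_gkComplex_succ_iff (uFormGroup α β) ρK ρ𝔤 hV 0 f).1 hfC).1 W hW).2
  have e := congrArg (fun g : Cochain ℝ (uFormGroup α β).lie (GKCarrier (uFormGroup α β) ρ𝔤) 0 => g ![]) h
  simp only [ins_apply, AlternatingMap.zero_apply] at e
  exact e

include hV in
/-- **`K`-equivariance**: `f(Ad k Y) = ρK k f(Y)`. [cite: BorelWallach2000, I §5.1 (3)] -/
theorem cval_Ad (hfC : f ∈ (gkComplex (uFormGroup α β) ρK ρ𝔤 hV).carrier 1) (k : (uFormGroup α β).maximalCompact)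
    (Y : (uFormGroup α β).lie) :
    cval ρ𝔤 f ((uFormGroup α β).Ad (Subgroup.inclusion (uFormGroup α β).maximalCompact_le_carrier k) Y) =
      ρK k (cval ρ𝔤 f Y) := by
  have h := ((mem_gkComplex_succ_iff (uFormGroup α β) ρK ρ𝔤 hV 0 f).1 hfC).2 k
  have e := congrArg (fun g : Cochain ℝ (uFormGroup α β).lie (GKCarrier (uFormGroup α β) ρ𝔤) 1 =>
    g ![(uFormGroup α β).Ad (Subgroup.inclusion (uFormGroup α β).maximalCompact_le_carrier k) Y]) h
  simp only [PairAction.act_apply] at e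
  have hv : (fun i : Fin 1 => (gkPairAction (uFormGroup α β) ρK ρ𝔤 hV).σ k⁻¹
      (![(uFormGroup α β).Ad (Subgroup.inclusion (uFormGroup α β).maximalCompact_le_carrier k) Y] i)) = ![Y] := by
    funext i
    fin_cases i
    exact (gkPairAction (uFormGroup α β) ρK ρ𝔤 hV).σ_apply_inv k Y
  rw [hv] at e
  exact e.symm

variable {δ : ℤ}

include hV in
/-- **`f(JY) = δ i · f(Y)`** for a closed `(𝔤, K)`-1-cochain of type `δ` (cocycle identity with `z₀ ∈ 𝔨` + the type
read on values). [cite: BorelWallach2000, II §4.2 (3)] -/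
theorem cval_lie_upqZ0 (hf : f ∈ upqType ρK ρ𝔤 hV 1 δ)
    (hd : d ℝ (uFormGroup α β).lie (GKCarrier (uFormGroup α β) ρ𝔤) 1 f = 0) (Y : (uFormGroup α β).lie) :
    cval ρ𝔤 f ⁅upqZ0 α β, Y⁆ = ((δ : ℂ) * Complex.I) • cval ρ𝔤 f Y := by
  obtain ⟨hfC, hfz⟩ := (mem_upqType_iff ρK ρ𝔤 hV 1 δ f).1 hf
  have h0 : f ![upqZ0 α β] = 0 := cval_eq_zero_of_mem_kInLie ρK ρ𝔤 hV f hfC _ upqZ0_mem_kInLie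
  have h := (d_one_eq_zero_iff (R := ℝ) f).1 hd (upqZ0 α β) Y
  rw [h0, lie_zero, sub_zero, GKCarrier.bracket_def] at h
  exact h.trans (hfz ![Y])

include hV in
/-- **`f(⁅W, Y⁆) = ρW f(Y)` for `W ∈ 𝔨`**. [cite: BorelWallach2000, I §5.1 (2)] -/
theorem cval_lieK (hf : f ∈ upqType ρK ρ𝔤 hV 1 δ)
    (hd : d ℝ (uFormGroup α β).lie (GKCarrier (uFormGroup α β) ρ𝔤) 1 f = 0) (W : (uFormGroup α β).lie)
    (hW : W ∈ (uFormGroup α β).kInLie) (Y : (uFormGroup α β).lie) : cval ρ𝔤 f ⁅W, Y⁆ = ρ𝔤 W (cval ρ𝔤 f Y) := by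
  obtain ⟨hfC, -⟩ := (mem_upqType_iff ρK ρ𝔤 hV 1 δ f).1 hf
  have h0 : f ![W] = 0 := cval_eq_zero_of_mem_kInLie ρK ρ𝔤 hV f hfC W hW
  have h := (d_one_eq_zero_iff (R := ℝ) f).1 hd W Y
  rw [h0, lie_zero, sub_zero, GKCarrier.bracket_def] at h
  exact h

include hV in
/-- **The values are `𝔭^{−δ}`-null** (★ T3j): `pOp (δi) x_s f(Y) = 0`. [cite: BorelWallach2000, II §4.2 (3)] -/
theorem pOp_cval (hδ : δ * δ = 1) (hf : f ∈ upqType ρK ρ𝔤 hV 1 δ)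
    (hd : d ℝ (uFormGroup α β).lie (GKCarrier (uFormGroup α β) ρ𝔤) 1 f = 0) (Y : (uFormGroup α β).lie)
    (s : (α × β) × Fin 2) : pOp ρ𝔤 ((δ : ℂ) * Complex.I) (upqPBasis s) (cval ρ𝔤 f Y) = 0 :=
  stubT3j_holds α β V ρK ρ𝔤 hV δ hδ f hf hd ![Y] s

include hV in
/-- The values have `z₀`-weight `δ i`. [cite: BorelWallach2000, II §4.2 (3)] -/
theorem z0_cval (hf : f ∈ upqType ρK ρ𝔤 hV 1 δ) (Y : (uFormGroup α β).lie) :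
    ρ𝔤 (upqZ0 α β) (cval ρ𝔤 f Y) = ((δ : ℂ) * Complex.I) • cval ρ𝔤 f Y :=
  ((mem_upqType_iff ρK ρ𝔤 hV 1 δ f).1 hf).2 ![Y]

/-- `X_{cE_p} = (Re c) X_{E_p} + (Im c) J X_{E_p}`. [cite: BorelWallach2000, II §4.1] -/
theorem upqUnit_eq_re_add_im (p : α × β) (c : ℂ) :
    upqUnit p c = (c.re : ℝ) • upqUnit p 1 + (c.im : ℝ) • ⁅upqZ0 α β, upqUnit p 1⁆ := by
  rw [lie_upqZ0_upqUnit, upq_real_smul_upqUnit, upq_real_smul_upqUnit, upqUnit_add, mul_one, mul_one]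
  congr 1
  exact (Complex.re_add_im c).symm

include hV in
/-- **`f(X_{cE_p}) = (Re c + Im c · δ i) f(X_{E_p})`**. [cite: BorelWallach2000, II §4.2 (3)] -/
theorem cval_upqUnit (hf : f ∈ upqType ρK ρ𝔤 hV 1 δ)
    (hd : d ℝ (uFormGroup α β).lie (GKCarrier (uFormGroup α β) ρ𝔤) 1 f = 0) (p : α × β) (c : ℂ) :
    cval ρ𝔤 f (upqUnit p c) = ((c.re : ℂ) + (c.im : ℂ) * ((δ : ℂ) * Complex.I)) • cval ρ𝔤 f (upqUnit p 1) := by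
  rw [upqUnit_eq_re_add_im p c, cval_add, cval_smul, cval_smul, cval_lie_upqZ0 ρK ρ𝔤 hV f hf hd, smul_smul, ← add_smul]

include hV in
/-- `f(X_{icE_p}) = δ i · f(X_{cE_p})` (`X_{icE_p} = J X_{cE_p}`). [cite: BorelWallach2000, II §4.2 (3)] -/
theorem cval_upqUnit_I (hf : f ∈ upqType ρK ρ𝔤 hV 1 δ)
    (hd : d ℝ (uFormGroup α β).lie (GKCarrier (uFormGroup α β) ρ𝔤) 1 f = 0) (p : α × β) (c : ℂ) :
    cval ρ𝔤 f (upqUnit p (Complex.I * c)) = ((δ : ℂ) * Complex.I) • cval ρ𝔤 f (upqUnit p c) := by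
  rw [← lie_upqZ0_upqUnit, cval_lie_upqZ0 ρK ρ𝔤 hV f hf hd]

/-! ## §3 The null core `E_f = span_ℂ {f(X_{E_p})}` -/

include hV in
/-- **Every value of `f` lies in `E_f`** (`𝔤 = 𝔨 + Σ ℝ x_s`, `f(𝔨) = 0`). [cite: BorelWallach2000, II §1.1 (3), §4.2 (3)] -/
theorem cval_mem_span (hf : f ∈ upqType ρK ρ𝔤 hV 1 δ)
    (hd : d ℝ (uFormGroup α β).lie (GKCarrier (uFormGroup α β) ρ𝔤) 1 f = 0) (Y : (uFormGroup α β).lie) :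
    cval ρ𝔤 f Y ∈ Submodule.span ℂ (Set.range fun p : α × β => cval ρ𝔤 f (upqUnit p 1)) := by
  obtain ⟨hfC, -⟩ := (mem_upqType_iff ρK ρ𝔤 hV 1 δ f).1 hf
  obtain ⟨W, hW, c, rfl⟩ := upq_exists_kInLie_add_sum_upqPBasis Y
  rw [cval_add, cval_eq_zero_of_mem_kInLie ρK ρ𝔤 hV f hfC W hW, zero_add, cval_sum_smul]
  refine Submodule.sum_mem _ fun s _ => Submodule.smul_mem _ _ ?_
  rw [upqPBasis, cval_upqUnit ρK ρ𝔤 hV f hf hd]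
  exact Submodule.smul_mem _ _ (Submodule.subset_span ⟨s.1, rfl⟩)

include hV in
/-- **`E_f` consists of `𝔭^{−δ}`-null vectors** (★ T3j on the generators). [cite: BorelWallach2000, II §4.2 (3)] -/
theorem span_null (hδ : δ * δ = 1) (hf : f ∈ upqType ρK ρ𝔤 hV 1 δ)
    (hd : d ℝ (uFormGroup α β).lie (GKCarrier (uFormGroup α β) ρ𝔤) 1 f = 0) :
    ∀ e ∈ Submodule.span ℂ (Set.range fun p : α × β => cval ρ𝔤 f (upqUnit p 1)), ∀ s : (α × β) × Fin 2,
      pOp ρ𝔤 ((δ : ℂ) * Complex.I) (upqPBasis s) e = 0 := by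
  intro e he s
  refine Submodule.span_induction (p := fun e _ => pOp ρ𝔤 ((δ : ℂ) * Complex.I) (upqPBasis s) e = 0) ?_ ?_ ?_ ?_ he
  · rintro _ ⟨p, rfl⟩
    exact pOp_cval ρK ρ𝔤 hV f hδ hf hd _ s
  · exact map_zero _
  · intro x y _ _ hx hy; rw [map_add, hx, hy, add_zero]
  · intro c x _ hx; rw [map_smul, hx, smul_zero]

include hV in
/-- **`E_f` is `𝔨`-stable** (`ρW f(X_{E_p}) = f(⁅W, X_{E_p}⁆) ∈ E_f`). [cite: BorelWallach2000, II §4.2 (3)] -/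
theorem span_lie_mem (hf : f ∈ upqType ρK ρ𝔤 hV 1 δ)
    (hd : d ℝ (uFormGroup α β).lie (GKCarrier (uFormGroup α β) ρ𝔤) 1 f = 0) :
    ∀ W ∈ (uFormGroup α β).kInLie, ∀ e ∈ Submodule.span ℂ (Set.range fun p : α × β => cval ρ𝔤 f (upqUnit p 1)),
      ρ𝔤 W e ∈ Submodule.span ℂ (Set.range fun p : α × β => cval ρ𝔤 f (upqUnit p 1)) := by
  intro W hW e he
  refine Submodule.span_induction
    (p := fun e _ => ρ𝔤 W e ∈ Submodule.span ℂ (Set.range fun p : α × β => cval ρ𝔤 f (upqUnit p 1))) ?_ ?_ ?_ ?_ he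
  · rintro _ ⟨p, rfl⟩
    rw [← cval_lieK ρK ρ𝔤 hV f hf hd W hW]
    exact cval_mem_span ρK ρ𝔤 hV f hf hd _
  · rw [map_zero]; exact Submodule.zero_mem _
  · intro x y _ _ hx hy; rw [map_add]; exact Submodule.add_mem _ hx hy
  · intro c x _ hx; rw [map_smul]; exact Submodule.smul_mem _ _ hx

include hV in
/-- **`E_f` is `K`-stable** (`ρK k f(X_{E_p}) = f(Ad k X_{E_p}) ∈ E_f`). [cite: BorelWallach2000, I §5.1 (3)] -/
theorem span_K_mem (hf : f ∈ upqType ρK ρ𝔤 hV 1 δ)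
    (hd : d ℝ (uFormGroup α β).lie (GKCarrier (uFormGroup α β) ρ𝔤) 1 f = 0) :
    ∀ (k : (uFormGroup α β).maximalCompact), ∀ e ∈ Submodule.span ℂ (Set.range fun p : α × β => cval ρ𝔤 f (upqUnit p 1)),
      ρK k e ∈ Submodule.span ℂ (Set.range fun p : α × β => cval ρ𝔤 f (upqUnit p 1)) := by
  obtain ⟨hfC, -⟩ := (mem_upqType_iff ρK ρ𝔤 hV 1 δ f).1 hf
  intro k e he
  refine Submodule.span_induction
    (p := fun e _ => ρK k e ∈ Submodule.span ℂ (Set.range fun p : α × β => cval ρ𝔤 f (upqUnit p 1))) ?_ ?_ ?_ ?_ he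
  · rintro _ ⟨p, rfl⟩
    rw [← cval_Ad ρK ρ𝔤 hV f hfC k]
    exact cval_mem_span ρK ρ𝔤 hV f hf hd _
  · rw [map_zero]; exact Submodule.zero_mem _
  · intro x y _ _ hx hy; rw [map_add]; exact Submodule.add_mem _ hx hy
  · intro c x _ hx; rw [map_smul]; exact Submodule.smul_mem _ _ hx

include hV in
/-- **`E_f` has `z₀`-weight `δ i`**. [cite: BorelWallach2000, II §4.2 (3)] -/
theorem span_weight (hf : f ∈ upqType ρK ρ𝔤 hV 1 δ) :
    ∀ e ∈ Submodule.span ℂ (Set.range fun p : α × β => cval ρ𝔤 f (upqUnit p 1)),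
      ρ𝔤 (upqZ0 α β) e = ((δ : ℂ) * Complex.I) • e := by
  intro e he
  refine Submodule.span_induction (p := fun e _ => ρ𝔤 (upqZ0 α β) e = ((δ : ℂ) * Complex.I) • e) ?_ ?_ ?_ ?_ he
  · rintro _ ⟨p, rfl⟩
    exact z0_cval ρK ρ𝔤 hV f hf _
  · rw [map_zero, smul_zero]
  · intro x y _ _ hx hy; rw [map_add, hx, hy, smul_add]
  · intro c x _ hx; rw [map_smul, hx, smul_comm]

include hV in
/-- `E_f ≠ 0` for `f ≠ 0`. [folklore] -/
theorem span_ne_bot (hf : f ∈ upqType ρK ρ𝔤 hV 1 δ)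
    (hd : d ℝ (uFormGroup α β).lie (GKCarrier (uFormGroup α β) ρ𝔤) 1 f = 0) (hf0 : f ≠ 0) :
    Submodule.span ℂ (Set.range fun p : α × β => cval ρ𝔤 f (upqUnit p 1)) ≠ ⊥ := by
  intro h0
  refine hf0 ((eq_zero_iff_cval ρ𝔤 f).2 fun Y => ?_)
  have hmem := cval_mem_span ρK ρ𝔤 hV f hf hd Y
  rw [h0, Submodule.mem_bot] at hmem
  exact hmem

include hV in
/-- **In an irreducible module, `eigenspace(ρz₀, δ i) = E_f` for every non-zero closed cochain `f` of type `δ`.**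
[cite: BorelWallach2000, II §4.1, VI 4.11 (3)] -/
theorem eigenspace_eq_span (hirr : IsIrreducibleGK ρK ρ𝔤) (hδ : δ * δ = 1) (hf : f ∈ upqType ρK ρ𝔤 hV 1 δ)
    (hd : d ℝ (uFormGroup α β).lie (GKCarrier (uFormGroup α β) ρ𝔤) 1 f = 0) (hf0 : f ≠ 0) :
    Module.End.eigenspace (ρ𝔤 (upqZ0 α β)) ((δ : ℂ) * Complex.I) =
      Submodule.span ℂ (Set.range fun p : α × β => cval ρ𝔤 f (upqUnit p 1)) := by
  have hμ : ((δ : ℂ) * Complex.I) * ((δ : ℂ) * Complex.I) = -1 := by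
    have hδC : (δ : ℂ) * (δ : ℂ) = 1 := by exact_mod_cast hδ
    rw [mul_mul_mul_comm, hδC, Complex.I_mul_I, one_mul]
  exact eigenspace_eq_of_isNullCore hirr hV hμ (span_null ρK ρ𝔤 hV f hδ hf hd) (span_lie_mem ρK ρ𝔤 hV f hf hd)
    (span_K_mem ρK ρ𝔤 hV f hf hd) (span_weight ρK ρ𝔤 hV f hf) (span_ne_bot ρK ρ𝔤 hV f hf hd hf0)

include hV in
/-- **Hence the values of ANY closed cochain `g` of type `δ` lie in `E_f`** (irreducible module, `f ≠ 0`).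
[cite: BorelWallach2000, II §4.1, VI 4.11 (3)] -/
theorem cval_mem_span_of_ne_zero (hirr : IsIrreducibleGK ρK ρ𝔤) (hδ : δ * δ = 1) (hf : f ∈ upqType ρK ρ𝔤 hV 1 δ)
    (hd : d ℝ (uFormGroup α β).lie (GKCarrier (uFormGroup α β) ρ𝔤) 1 f = 0) (hf0 : f ≠ 0)
    (g : Cochain ℝ (uFormGroup α β).lie (GKCarrier (uFormGroup α β) ρ𝔤) 1) (hg : g ∈ upqType ρK ρ𝔤 hV 1 δ)
    (Y : (uFormGroup α β).lie) :
    cval ρ𝔤 g Y ∈ Submodule.span ℂ (Set.range fun p : α × β => cval ρ𝔤 f (upqUnit p 1)) := by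
  rw [← eigenspace_eq_span ρK ρ𝔤 hV f hirr hδ hf hd hf0, Module.End.mem_eigenspace_iff]
  exact z0_cval ρK ρ𝔤 hV g hg Y

end Summit.HodgeConjecture.HodgeConjecture.Cruxes.H413.F0P3bCochainValues

end
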